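import Summits.SmoothPoincare4.SmoothPoincare4.Theorems.ConvexBisectionAcyclicBisectionExistsBeltLongitudeModel
import Literature.Topology.FourManifolds.AttachingMapBoundaryTube
import HarnessLib

/-!
# The framed `r`-longitude of an attaching circle, II: direction maps and the ambient fibre vector
(node T3c-1 `node_belt_isotopic_pushoff` of the sub-goal T3 of stub `stub_steinRealisation` (NF6), line
`modp-braid-orbits`, crux `ConvexBisection.AcyclicBisectionExists`, item stmt-SmoothPoincare4-10508;
wave 3, worker Z5, lead c5; stages (3a) and (3c) of V6-REPORT §2)

The sphere part `T ∩ ∂D⁴` of Kosinski's tube has the coordinates `(ψ, v) ↦ depthLine ψ v 0 =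
(√(1-‖v‖²) ψ, v)` (`HandleTubeDepthField.lean`; the coordinates of the boundary tube
`HandleAttachingMap.boundaryTube`).  This file fixes the model-side data of the fibre framings of the
`r`-longitude:

* §1 the direction maps `uDir b θ = (θ₀, σ θ₁) ∈ 𝕊¹` (`σ = slideSign b`) and `sqDir θ = θ² ∈ ℝ²`, smooth;
  the `ρ`-longitude point is `depthLine (uDir b θ) (ρ θ) 0` (`depthLine_uDir_smul`);
* §2 the ambient fibre vector `fibreVec ψ v ζ = (−(⟪v,ζ⟫/√(1-‖v‖²)) ψ, ζ) ∈ ℝ⁴`, the velocity of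
  `ε ↦ (√(1-‖v+εζ‖²) ψ, v + εζ)` (`hasDerivAt_mkVec_line`), orthogonal to the point
  (`inner_mkVec_fibreVec`); at the longitude, `fibreVec (uDir b θ) (r θ) θ² = twistVec`
  (`fibreVec_longitude`): the one-twist framing vector of `…BeltLongitudeModel.lean`;
* §3 registered helper `helper_belt_fibreDirections`.

Everything is proved; no named facts.

## References
* A. A. Kosinski, *Differential Manifolds*, Academic Press (1993), VI §5 (5.1), §6. [Kosinski1993]
* R. C. Kirby, *The Topology of 4-Manifolds*, LNM 1374 (1989), Ch. I §2 (framings). [Kirby1989]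
-/

noncomputable section

-- the prescribed namespace `Summit.<P>.<Sub>.…` duplicates `SmoothPoincare4` (P = Sub)
set_option linter.dupNamespace false

open scoped Manifold ContDiff Topology RealInnerProductSpace
open Set Function Metric Real Bundle

namespace Summit.SmoothPoincare4.SmoothPoincare4.Theorems.AcyclicBisectionExists.ModpBraidOrbits

open Literature.Topology.FourManifolds Literature.Topology.FourManifolds.HandleAttachingMap
  Literature.Geometry.Symplectic

/-! ### §1 The direction maps -/

/-- The linear map `(x₀, x₁) ↦ (x₀, σ x₁)` of `ℝ²` (`σ = slideSign b`). [folklore] -/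
def uDirLin (b : Bool) : EuclideanSpace ℝ (Fin 2) →L[ℝ] EuclideanSpace ℝ (Fin 2) :=
  LinearMap.toContinuousLinearMap
    { toFun := fun x => WithLp.toLp 2 ![x 0, slideSign b * x 1]
      map_add' := fun x y => by ext i; fin_cases i <;> simp [mul_add]
      map_smul' := fun c x => by ext i; fin_cases i <;> simp [mul_left_comm] }

/-- `uDirLin` on coordinates. [folklore] -/
@[simp] theorem uDirLin_apply (b : Bool) (x : EuclideanSpace ℝ (Fin 2)) :
    uDirLin b x = WithLp.toLp 2 ![x 0, slideSign b * x 1] := rfl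

/-- `uDirLin` preserves the unit circle. [folklore] -/
theorem norm_uDirLin (b : Bool) (θ : sphere (0 : EuclideanSpace ℝ (Fin 2)) 1) :
    ‖uDirLin b (θ : EuclideanSpace ℝ (Fin 2))‖ = 1 := by
  have hθ : (θ : EuclideanSpace ℝ (Fin 2)) 0 ^ 2 + (θ : EuclideanSpace ℝ (Fin 2)) 1 ^ 2 = 1 := by
    have h2 : ‖(θ : EuclideanSpace ℝ (Fin 2))‖ ^ 2 = 1 := by rw [norm_eq_of_mem_sphere θ, one_pow]
    rwa [EuclideanSpace.real_norm_sq_eq, Fin.sum_univ_two] at h2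
  have e : ‖uDirLin b (θ : EuclideanSpace ℝ (Fin 2))‖ ^ 2 = 1 := by
    rw [EuclideanSpace.real_norm_sq_eq, Fin.sum_univ_two]
    simp
    linear_combination hθ + ((θ : EuclideanSpace ℝ (Fin 2)) 1 ^ 2) * slideSign_sq b
  nlinarith [norm_nonneg (uDirLin b (θ : EuclideanSpace ℝ (Fin 2)))]

/-- **The direction map `u_b (θ) = (θ₀, σ θ₁)` of the circle** (identity for `b = false`, complex
conjugation for `b = true`): the angle along the attaching circle of the `r`-longitude point of
meridional angle `θ`. [folklore] -/
def uDir (b : Bool) (θ : sphere (0 : EuclideanSpace ℝ (Fin 2)) 1) : sphere (0 : EuclideanSpace ℝ (Fin 2)) 1 :=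
  ⟨uDirLin b (θ : EuclideanSpace ℝ (Fin 2)), mem_sphere_zero_iff_norm.2 (norm_uDirLin b θ)⟩

/-- The vector of `u_b (θ)`. [folklore] -/
@[simp] theorem coe_uDir (b : Bool) (θ : sphere (0 : EuclideanSpace ℝ (Fin 2)) 1) :
    ((uDir b θ : sphere (0 : EuclideanSpace ℝ (Fin 2)) 1) : EuclideanSpace ℝ (Fin 2)) =
      WithLp.toLp 2 ![(θ : EuclideanSpace ℝ (Fin 2)) 0, slideSign b * (θ : EuclideanSpace ℝ (Fin 2)) 1] := rfl

/-- The direction map is smooth. [folklore] -/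
theorem contMDiff_uDir (b : Bool) : ContMDiff (𝓡 1) (𝓡 1) ∞ (uDir b) := by
  haveI := Fact.mk (@finrank_euclideanSpace_fin ℝ _ 2)
  exact ((uDirLin b).contDiff.contMDiff.comp contMDiff_coe_sphere).codRestrict_sphere _

/-- **The squaring direction `θ² = (θ₀² − θ₁², 2 θ₀ θ₁) ∈ ℝ²`**: the fibre direction of the one-twist
framing. [folklore] -/
def sqDir (θ : sphere (0 : EuclideanSpace ℝ (Fin 2)) 1) : EuclideanSpace ℝ (Fin 2) :=
  WithLp.toLp 2 ![(θ : EuclideanSpace ℝ (Fin 2)) 0 ^ 2 - (θ : EuclideanSpace ℝ (Fin 2)) 1 ^ 2,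
    2 * (θ : EuclideanSpace ℝ (Fin 2)) 0 * (θ : EuclideanSpace ℝ (Fin 2)) 1]

/-- The polynomial squaring map `(x₀, x₁) ↦ (x₀² − x₁², 2 x₀ x₁)` of `ℝ²`. [folklore] -/
def sqMap (x : EuclideanSpace ℝ (Fin 2)) : EuclideanSpace ℝ (Fin 2) :=
  WithLp.toLp 2 ![x 0 ^ 2 - x 1 ^ 2, 2 * x 0 * x 1]

/-- The squaring map is smooth. [folklore] -/
theorem contDiff_sqMap : ContDiff ℝ ∞ sqMap := by
  have h0 : ContDiff ℝ ∞ fun x : EuclideanSpace ℝ (Fin 2) => x 0 := contDiff_piLp_apply 2 (i := (0 : Fin 2))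
  have h1 : ContDiff ℝ ∞ fun x : EuclideanSpace ℝ (Fin 2) => x 1 := contDiff_piLp_apply 2 (i := (1 : Fin 2))
  refine contDiff_piLp' 2 fun i => ?_
  fin_cases i
  · simpa [sqMap] using (h0.pow 2).sub (h1.pow 2)
  · simpa [sqMap, mul_assoc] using (contDiff_const (c := (2 : ℝ))).mul (h0.mul h1)

/-- `sqDir = sqMap ∘ coe`. [folklore] -/
theorem sqDir_eq (θ : sphere (0 : EuclideanSpace ℝ (Fin 2)) 1) : sqDir θ = sqMap (θ : EuclideanSpace ℝ (Fin 2)) := rfl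

/-- The squaring direction is smooth. [folklore] -/
theorem contMDiff_sqDir : ContMDiff (𝓡 1) 𝓘(ℝ, EuclideanSpace ℝ (Fin 2)) ∞ sqDir := by
  haveI := Fact.mk (@finrank_euclideanSpace_fin ℝ _ 2)
  exact contDiff_sqMap.contMDiff.comp contMDiff_coe_sphere

/-- `‖ρ θ‖ = ρ` for `ρ ≥ 0`. [folklore] -/
theorem norm_smul_coe_sphere' {ρ : ℝ} (h0 : 0 ≤ ρ) (θ : sphere (0 : EuclideanSpace ℝ (Fin 2)) 1) :
    ‖ρ • (θ : EuclideanSpace ℝ (Fin 2))‖ = ρ := by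
  rw [norm_smul, Real.norm_eq_abs, abs_of_nonneg h0, norm_eq_of_mem_sphere θ, mul_one]

/-- **The `ρ`-longitude point is the sphere point of angle `u_b(θ)` and fibre `ρ θ`**:
`depthLine (u_b θ) (ρ θ) 0 = tubeLongitudePt b ρ θ` (`0 ≤ ρ < 1`). [cite: Kosinski1993, VI §5 (5.1)] -/
theorem depthLine_uDir_smul (b : Bool) {ρ : ℝ} (h0 : 0 ≤ ρ) (h1 : ρ < 1)
    (θ : sphere (0 : EuclideanSpace ℝ (Fin 2)) 1) :
    depthLine (uDir b θ) (ρ • (θ : EuclideanSpace ℝ (Fin 2))) 0 = tubeLongitudePt b ρ θ := by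
  have hn : ‖ρ • (θ : EuclideanSpace ℝ (Fin 2))‖ = ρ := norm_smul_coe_sphere' h0 θ
  have hpos : 0 < 1 - 0 - ‖ρ • (θ : EuclideanSpace ℝ (Fin 2))‖ ^ 2 := by rw [hn]; nlinarith
  apply Subtype.ext; apply Subtype.ext
  change tubeVec (depthLine (uDir b θ) (ρ • (θ : EuclideanSpace ℝ (Fin 2))) 0) = _
  rw [tubeVec_depthLine _ _ le_rfl hpos, coe_coe_tubeLongitudePt b (by nlinarith) θ]
  simp only [mkVec, hn, sub_zero]
  ext i
  fin_cases i <;> simp [tubeLongitudeVec, lamEmbed, muEmbed]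
  ring

/-! ### §2 The ambient fibre vector -/

/-- **The ambient fibre vector** `fibreVec ψ v ζ = (−(⟪v,ζ⟫/√(1-‖v‖²)) ψ, ζ) ∈ ℝ⁴`: the velocity of
`ε ↦ (√(1-‖v+εζ‖²) ψ, v + εζ)` at `ε = 0`. [folklore] -/
def fibreVec (ψ : sphere (0 : EuclideanSpace ℝ (Fin 2)) 1) (v ζ : EuclideanSpace ℝ (Fin 2)) :
    EuclideanSpace ℝ (Fin 4) :=
  (-(⟪v, ζ⟫ / Real.sqrt (1 - ‖v‖ ^ 2))) • lamEmbed (ψ : EuclideanSpace ℝ (Fin 2)) + muEmbed ζ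

/-- `⟪(u, 0), (u', 0)⟫ = ⟪u, u'⟫`. [folklore] -/
theorem inner_lamEmbed_lamEmbed (u u' : EuclideanSpace ℝ (Fin 2)) : ⟪lamEmbed u, lamEmbed u'⟫ = ⟪u, u'⟫ := by
  simp [lamEmbed, EuclideanSpace.inner_eq_star_dotProduct, Fin.sum_univ_four, Fin.sum_univ_two, dotProduct]

/-- `⟪(0, v), (u, 0)⟫ = 0`. [folklore] -/
theorem inner_muEmbed_lamEmbed (v u : EuclideanSpace ℝ (Fin 2)) : ⟪muEmbed v, lamEmbed u⟫ = 0 := by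
  rw [real_inner_comm]; exact inner_lamEmbed_muEmbed u v

/-- `⟪(0, v), (0, w)⟫ = ⟪v, w⟫`. [folklore] -/
theorem inner_muEmbed_muEmbed (v w : EuclideanSpace ℝ (Fin 2)) : ⟪muEmbed v, muEmbed w⟫ = ⟪v, w⟫ := by
  simp [muEmbed, EuclideanSpace.inner_eq_star_dotProduct, Fin.sum_univ_four, Fin.sum_univ_two, dotProduct]

/-- **The fibre vector is orthogonal to the point** `(√(1-‖v‖²) ψ, v)` (`‖v‖ < 1`): it is tangent to
the sphere. [folklore] -/
theorem inner_mkVec_fibreVec (ψ : sphere (0 : EuclideanSpace ℝ (Fin 2)) 1) {v : EuclideanSpace ℝ (Fin 2)}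
    (hv : ‖v‖ < 1) (ζ : EuclideanSpace ℝ (Fin 2)) :
    ⟪mkVec (ψ : EuclideanSpace ℝ (Fin 2)) v 0, fibreVec ψ v ζ⟫ = 0 := by
  have hc : 0 < Real.sqrt (1 - ‖v‖ ^ 2) := Real.sqrt_pos.2 (by nlinarith [norm_nonneg v])
  have hψ : ⟪(ψ : EuclideanSpace ℝ (Fin 2)), (ψ : EuclideanSpace ℝ (Fin 2))⟫ = 1 := by
    rw [real_inner_self_eq_norm_sq, norm_eq_of_mem_sphere ψ, one_pow]
  simp only [mkVec, fibreVec, sub_zero, inner_add_left, inner_add_right, inner_smul_left, inner_smul_right,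
    inner_lamEmbed_muEmbed, inner_lamEmbed_lamEmbed, inner_muEmbed_lamEmbed,
    inner_muEmbed_muEmbed, hψ, conj_trivial, mul_zero, zero_add, mul_one]
  field_simp
  ring

/-- **At the `r`-longitude the fibre vector of the squaring direction is the one-twist framing vector**:
`fibreVec (u_b θ) (r θ) θ² = X_{θ²}` (`0 ≤ r`). [folklore] -/
theorem fibreVec_longitude (b : Bool) {r : ℝ} (h0 : 0 ≤ r) (θ : sphere (0 : EuclideanSpace ℝ (Fin 2)) 1) :
    fibreVec (uDir b θ) (r • (θ : EuclideanSpace ℝ (Fin 2))) (sqDir θ) =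
      WithLp.toLp 2 (twistVec (slideSign b) r ((θ : EuclideanSpace ℝ (Fin 2)) 0) ((θ : EuclideanSpace ℝ (Fin 2)) 1)) := by
  have hθ : (θ : EuclideanSpace ℝ (Fin 2)) 0 ^ 2 + (θ : EuclideanSpace ℝ (Fin 2)) 1 ^ 2 = 1 := by
    have h2 : ‖(θ : EuclideanSpace ℝ (Fin 2))‖ ^ 2 = 1 := by rw [norm_eq_of_mem_sphere θ, one_pow]
    rwa [EuclideanSpace.real_norm_sq_eq, Fin.sum_univ_two] at h2
  have hn : ‖r • (θ : EuclideanSpace ℝ (Fin 2))‖ = r := norm_smul_coe_sphere' h0 θ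
  have hin0 : ⟪(θ : EuclideanSpace ℝ (Fin 2)), sqDir θ⟫ = (θ : EuclideanSpace ℝ (Fin 2)) 0 := by
    simp [sqDir, EuclideanSpace.inner_eq_star_dotProduct, Fin.sum_univ_two, dotProduct]
    linear_combination ((θ : EuclideanSpace ℝ (Fin 2)) 0) * hθ
  have hin : ⟪r • (θ : EuclideanSpace ℝ (Fin 2)), sqDir θ⟫ = r * (θ : EuclideanSpace ℝ (Fin 2)) 0 := by
    rw [inner_smul_left, conj_trivial, hin0]
  rw [fibreVec, hin, hn]
  ext i
  fin_cases i <;> simp [twistVec, lamEmbed, muEmbed, sqDir] <;> ring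

/-- **The velocity of `ε ↦ (√(1-‖v+εζ‖²) ψ, v + εζ)` at `ε = 0` is the fibre vector** (`‖v‖ < 1`).
[folklore] -/
theorem hasDerivAt_mkVec_line (ψ : sphere (0 : EuclideanSpace ℝ (Fin 2)) 1) {v : EuclideanSpace ℝ (Fin 2)}
    (hv : ‖v‖ < 1) (ζ : EuclideanSpace ℝ (Fin 2)) :
    HasDerivAt (fun ε : ℝ => mkVec (ψ : EuclideanSpace ℝ (Fin 2)) (v + ε • ζ) 0) (fibreVec ψ v ζ) 0 := by
  have hpos : 0 < 1 - ‖v‖ ^ 2 := by nlinarith [norm_nonneg v]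
  have e : (fun ε : ℝ => mkVec (ψ : EuclideanSpace ℝ (Fin 2)) (v + ε • ζ) 0) = fun ε =>
      Real.sqrt (1 - ‖v + ε • ζ‖ ^ 2) • lamEmbed (ψ : EuclideanSpace ℝ (Fin 2)) + muEmbed (v + ε • ζ) := by
    funext ε; simp only [mkVec, sub_zero]
  rw [e]
  -- `ε ↦ ‖v + εζ‖²` and its derivative `2⟪v, ζ⟫` at `0`
  have hline : HasDerivAt (fun ε : ℝ => v + ε • ζ) ζ 0 := by
    simpa using ((hasDerivAt_id (0 : ℝ)).smul_const ζ).const_add v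
  have hsq : HasDerivAt (fun ε : ℝ => ‖v + ε • ζ‖ ^ 2) (2 * ⟪v, ζ⟫) 0 := by
    have h := hline.norm_sq
    simpa only [zero_smul, add_zero] using h
  have hrad : HasDerivAt (fun ε : ℝ => 1 - ‖v + ε • ζ‖ ^ 2) (-(2 * ⟪v, ζ⟫)) 0 := by
    simpa using hsq.const_sub (1 : ℝ)
  have hsqrt : HasDerivAt (fun ε : ℝ => Real.sqrt (1 - ‖v + ε • ζ‖ ^ 2))
      (-(2 * ⟪v, ζ⟫) / (2 * Real.sqrt (1 - ‖v‖ ^ 2))) 0 := by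
    have h := hrad.sqrt (by simp; nlinarith [norm_nonneg v])
    simpa only [zero_smul, add_zero] using h
  have h1 : HasDerivAt (fun ε : ℝ => Real.sqrt (1 - ‖v + ε • ζ‖ ^ 2) • lamEmbed (ψ : EuclideanSpace ℝ (Fin 2)))
      ((-(2 * ⟪v, ζ⟫) / (2 * Real.sqrt (1 - ‖v‖ ^ 2))) • lamEmbed (ψ : EuclideanSpace ℝ (Fin 2))) 0 :=
    hsqrt.smul_const _
  have h2 : HasDerivAt (fun ε : ℝ => muEmbed (v + ε • ζ)) (muEmbed ζ) 0 := by
    have e : (fun ε : ℝ => muEmbed (v + ε • ζ)) = fun ε => muEmbed v + ε • muEmbed ζ := by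
      funext ε; rw [muEmbed_add, muEmbed_smul]
    rw [e]
    simpa using ((hasDerivAt_id (0 : ℝ)).smul_const (muEmbed ζ)).const_add (muEmbed v)
  refine (h1.add h2).congr_deriv ?_
  rw [fibreVec]
  congr 1
  field_simp

/-! ### §3 Registered helper -/

/-- **Registered helper `helper_belt_fibreDirections` (node T3c-1 of NF6 `stub_steinRealisation`, stages
(3a)/(3c), wave 3, lead c5): in the sphere coordinates `(ψ, v) ↦ depthLine ψ v 0` of Kosinski's tube the
`ρ`-longitude point of meridional angle `θ` is `(ψ, v) = ((θ₀, ∓θ₁), ρ θ)`, and there the ambient fibre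
vector of the squaring direction `θ²` is the one-twist framing vector
`(−(ρ/√(1-ρ²)) θ₀², ∓(ρ/√(1-ρ²)) θ₀ θ₁, θ₀² − θ₁², 2 θ₀ θ₁)`.** [cite: Kosinski1993, VI §6] -/
theorem helper_belt_fibreDirections :
    ∀ (b : Bool) (ρ : ℝ) (θ : Metric.sphere (0 : EuclideanSpace ℝ (Fin 2)) 1), 0 ≤ ρ → ρ < 1 →
      Literature.Topology.FourManifolds.depthLine
        (Summit.SmoothPoincare4.SmoothPoincare4.Theorems.AcyclicBisectionExists.ModpBraidOrbits.uDir b θ)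
        (ρ • (θ : EuclideanSpace ℝ (Fin 2))) 0 =
        Summit.SmoothPoincare4.SmoothPoincare4.Theorems.AcyclicBisectionExists.ModpBraidOrbits.tubeLongitudePt b ρ θ ∧
      Summit.SmoothPoincare4.SmoothPoincare4.Theorems.AcyclicBisectionExists.ModpBraidOrbits.fibreVec
        (Summit.SmoothPoincare4.SmoothPoincare4.Theorems.AcyclicBisectionExists.ModpBraidOrbits.uDir b θ)
        (ρ • (θ : EuclideanSpace ℝ (Fin 2)))
        (Summit.SmoothPoincare4.SmoothPoincare4.Theorems.AcyclicBisectionExists.ModpBraidOrbits.sqDir θ) =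
        WithLp.toLp 2 ![-(ρ / Real.sqrt (1 - ρ ^ 2) * (θ : EuclideanSpace ℝ (Fin 2)) 0 ^ 2),
          -(ρ / Real.sqrt (1 - ρ ^ 2) * (if b then -1 else 1) * (θ : EuclideanSpace ℝ (Fin 2)) 0 *
            (θ : EuclideanSpace ℝ (Fin 2)) 1),
          (θ : EuclideanSpace ℝ (Fin 2)) 0 ^ 2 - (θ : EuclideanSpace ℝ (Fin 2)) 1 ^ 2,
          2 * (θ : EuclideanSpace ℝ (Fin 2)) 0 * (θ : EuclideanSpace ℝ (Fin 2)) 1] := by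
  intro b ρ θ h0 h1
  exact ⟨depthLine_uDir_smul b h0 h1 θ, fibreVec_longitude b h0 θ⟩

end Summit.SmoothPoincare4.SmoothPoincare4.Theorems.AcyclicBisectionExists.ModpBraidOrbits

end
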